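import Summits.AtomisticToContinuum.BoseEinsteinCondensation.Theorems.PeriodicIRBound.Negative.GroundOccupation
import Summits.AtomisticToContinuum.BoseEinsteinCondensation.Theorems.BECGroundStateSOSPeriodicIRBoundWFDefs
import Literature.MathematicalPhysics.QuantumManyBody.CouplingPathSliceFloor
import HarnessLib

/-!
# Route `BECGroundStateSOS`, crux `PeriodicIRBound` (stmt-AtomisticToContinuum-3972),
# line `fsum-phase-pencil` — vocabulary and registered stub statements

`Defs` file of the crux line `fsum-phase-pencil`
(`Summits/AtomisticToContinuum/BoseEinsteinCondensation/Cruxes/PeriodicIRBound/Lines/fsum-phase-pencil.{md,lean}`, idea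
card `…/Cruxes/PeriodicIRBound/Ideas/fsum-phase-pencil.md`, ideator 2; triage r1-1/2/3: pass ×3, merged with
`backflow-susceptibility`; picked by line lead seat c7, `…/Cruxes/PeriodicIRBound/PICKED.md`). A `Cruxes/…/Lines/*.lean`
skeleton is not an importable module, so the objects the line posits and the STATEMENTS of its registered stubs live
here, imported verbatim by the stub files `Theorems/BECGroundStateSOSPeriodicIRBound<Stub>.lean` (landed
`--supports stmt-AtomisticToContinuum-3972`) and by the closing composition `PeriodicIRBound_of` of the skeleton.

**The line.** Two generators per mode `k ∈ ℤ³ ∖ {0}`, in FIRST quantisation over the tree's `C¹` periodic states: the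
density wave `ρ_k†Ψ = (∑ⱼ e_k(xⱼ))Ψ` (a multiplication operator, `[V, ρ_k†] = 0`, `(H − E₀)`-weight = the f-sum rule
`N‖k̃‖²`, `k̃ = 2πk/L`) and the number-conserving condensate PHASE transfer `U_kΨ = (a_k†a₀ − a₀†a₋ₖ)Ψ`. The kinetic
commutator splits EXACTLY, `W_k := [T, ρ_k†] = ‖k̃‖²U_k + R_k` (`R_k = ‖k̃‖J′_k`, the longitudinal current of the
non-condensate cloud), so Cauchy–Schwarz in the non-negative form `H − E₀` for the pair `(ρ_k†Ψ, U_kΨ)` reads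
`(‖k̃‖²‖U_kΨ‖² + β_k)² ≤ F·𝒴` with `F ≤ 2N‖k̃‖²` (f-sum), `𝒴 = Q_{E₀}(U_kΨ) ≲ N(‖k̃‖² + ρ)` (a double commutator) and
the BACKFLOW `β_k = Re⟨U_kΨ, R_kΨ⟩`; a quadratic inequality gives the `n₀`-weighted infrared bound
`‖U_kΨ‖² + ‖P_kΨ‖² ≤ C N√ρ L/‖k‖_∞` (`P_k = a_k†a₀ + a₀†a₋ₖ`, `‖U‖² + ‖P‖² = 2⟨n₀(n_k+1)⟩ + 2⟨n₋ₖ(n₀+1)⟩`), and the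
normalisation `⟨n₀n_k⟩ ↦ n_k` is a fixed-`(N, L)` bootstrap (weighted mode counting + no-cat + coupling continuity).

**Design (seat c7 reshape).** The planner's skeleton carried an ad-hoc first-quantised vocabulary (`Function.update`
integrals). This module states the SAME seven statements over the landed Wagner–Feynman toolkit of the sibling line
`linear-ph-floor-wagner` (`BECGroundStateSOSPeriodicIRBoundDefs` §2b `WF.qform/normSq/IsCore/formRe/innerRe`,
`Literature.…BoseGas.modeAn/modeCr` of `TorusFockLayer`, `waveVector` of `TorusBoseFockLayer`), so that the stub files
can use the ≈ 10 k landed lines `BECGroundStateSOSPeriodicIRBoundWF*.lean` (regularity `isCore_modeAn/modeCr`, form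
bounds `qform_modeAn_le/qform_modeCr_le`, near-minimiser polar bound `abs_formRe_sub_le`, variational principle
`groundStateEnergy_mul_normSq_le`, kinetic Parseval, CCR on plane-wave modes). Contents:

* vocabulary: `transfer L a b = a†(φ_a)a(φ_b)` (number-conserving one-body lift, `0` on `Config 0`), `phaseUp` (`U_k`),
  `condUp` (`P_k`), `kinCommutator` (`W_k = [T, ρ_k†]`, first derivatives only), `eform` (`Q_E(f) = 𝓔_w[f] − E‖f‖²` as a
  real number), `InClass` (the potential class `𝒱(R₀, V₁)`);
* the statements of the seven registered stubs as named, deliberately untagged `Prop`s (statements of a proof plan, not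
  results in print; the audit's advisory `vendored-fact` class is expected until the stub files provide witnesses):
  `BackflowBound` (S1, the load), `PhaseConeBlock` (S2), `PhaseDoubleCommutator` (S3), `CondensateDensityQuadrature` (S4),
  `CondensateNumberVarianceClass`/`CondensateNumberVariance` (S5a, no-cat), `WeightedClassBound` (output of S1–S4, input of
  S5), `NormalisationBootstrap` (S5), `NonIntegrableHalf` (S6 = the crux on hard cores, NOT reduced), and the typed
  alternative `StaticBackflowCurrent` for S1.

References: the f-sum rule and the Onsager–Feynman/Pitaevskii–Stringari uncertainty bounds — L. Pitaevskii, S. Stringari,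
J. Low Temp. Phys. 85 (1991) 377, §II; LSSY2005 App. A (second quantisation dictionary (A.13)–(A.14)); H. Wagner,
Z. Physik 195 (1966) 273.
-/

noncomputable section

open MeasureTheory Filter
open scoped ENNReal NNReal ComplexConjugate BigOperators

namespace Summit.AtomisticToContinuum.BoseEinsteinCondensation.Cruxes.PeriodicIRBound.FsumPhasePencil

open Literature.MathematicalPhysics.QuantumManyBody.BoseGas
open Summit.AtomisticToContinuum.BoseEinsteinCondensation.Theorems.PeriodicIRBound.Negative
  (NearMin InWindow IRBoundFor)
open Summit.AtomisticToContinuum.BoseEinsteinCondensation.Cruxes.PeriodicIRBound.LinearPhFloorWagner.WF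
  (qform normSq IsCore formRe innerRe)

/-! ## §1 Vocabulary (over `WF.*`, `modeAn`, `modeCr`, `planeWaveMode`, `waveVector`, `cellWave`) -/

section Vocabulary

/-- The number-conserving **one-body lift** `a†(φ_a) a(φ_b)` of the rank-one operator `|φ_a⟩⟨φ_b|`
(`φ_c = planeWaveMode L c = L^{-3/2} e_c`) on `N`-body functions, in first quantisation through the tree's
`modeCr`/`modeAn` (LSSY App. A (A.13)–(A.14)); the `√N` factors cancel:
`(transfer L a b Ψ)(X) = ∑ⱼ φ_a(xⱼ) ∫_cell conj(φ_b(y)) Ψ(y, X̂ⱼ) dy`. On `Config 0` it is `0` (no particle to move).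
[folklore] -/
def transfer (L : ℝ) (a b : Fin 3 → ℤ) : {N : ℕ} → (Config N → ℂ) → Config N → ℂ
  | 0, _ => 0
  | _ + 1, Ψ => modeCr (planeWaveMode L a) (modeAn L (planeWaveMode L b) Ψ)

/-- The condensate **phase-transfer quadrature** (raising the momentum by `k`) `U_k Ψ = (a_k† a₀ − a₀† a₋ₖ) Ψ`;
`U_k† = −U₋ₖ`; `‖U_kΨ‖² = ⟨n₀(n_k+1)⟩ + ⟨n₋ₖ(n₀+1)⟩ − 2Re⟨a₀†a₀†a_ka₋ₖ⟩` (Bogoliubov: the LARGE quadrature). [folklore] -/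
def phaseUp (L : ℝ) (k : Fin 3 → ℤ) {N : ℕ} (Ψ : Config N → ℂ) : Config N → ℂ :=
  fun X => transfer L k 0 Ψ X - transfer L 0 (-k) Ψ X

/-- The condensate **density-transfer quadrature** `P_k Ψ = (a_k† a₀ + a₀† a₋ₖ) Ψ`, the condensate-leg part of
`ρ_k† = ∑_p a†_{p+k} a_p`; `‖U_kΨ‖² + ‖P_kΨ‖² = 2⟨n₀(n_k+1)⟩ + 2⟨n₋ₖ(n₀+1)⟩` (parallelogram law). [folklore] -/
def condUp (L : ℝ) (k : Fin 3 → ℤ) {N : ℕ} (Ψ : Config N → ℂ) : Config N → ℂ :=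
  fun X => transfer L k 0 Ψ X + transfer L 0 (-k) Ψ X

/-- The **kinetic commutator** `W_k Ψ = [T, ρ_k†]Ψ = ∑ⱼ e_k(xⱼ) (‖k̃‖² Ψ − 2i ∂_{xⱼ·k̃} Ψ)` (`T = −∑Δⱼ`,
`ρ_k† = ∑ⱼ e_k(xⱼ)`, `e_k = cellWave L k`, `k̃ = waveVector L k = 2πk/L`; only FIRST derivatives of the `C¹` state
enter). On the plane wave `e_p`: `W_k e_p = (‖k̃‖² + 2k̃·p̃) e_{p+k}`, so `W_k = ‖k̃‖² U_k + R_k` with `R_k` killing the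
condensate legs `p ∈ {0, −k}`. [folklore] -/
def kinCommutator (L : ℝ) (k : Fin 3 → ℤ) {N : ℕ} (Ψ : Config N → ℂ) (X : Config N) : ℂ :=
  ∑ j : Fin N, cellWave L k (X j) *
    ((((‖waveVector L k‖ ^ 2 : ℝ)) : ℂ) * Ψ X - 2 * Complex.I * fderiv ℝ Ψ X (Pi.single j (waveVector L k)))

/-- The **shifted energy form** `Q_E(f) = 𝓔_w[f] − E‖f‖²` of an unnormalised function on the cell, as a real number
(`WF.qform`, `WF.normSq` converted by `toReal`; meaningful when `𝓔_w[f] < ∞`). With `E = E₀^per` it is `≥ 0` on core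
functions (`WF.groundStateEnergy_mul_normSq_le`). [folklore] -/
def eform (w : ℝ → ℝ≥0∞) (L : ℝ) (E : ℝ) {N : ℕ} (f : Config N → ℂ) : ℝ :=
  (qform w L f).toReal - E * (normSq L f).toReal

/-- The potential class `𝒱(R₀, V₁)`: measurable radial profile, range `≤ R₀`, `∫_{ℝ³} w(|x|) dx ≤ V₁` (hard cores
excluded; `0 ∈ 𝒱`; `λw ∈ 𝒱` for `λ ≤ 1`; an admissible integrable `v` lies in `𝒱(max R₀ 1, ∫v)`). [folklore] -/
def InClass (R₀ V₁ : ℝ) (w : ℝ → ℝ≥0∞) : Prop :=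
  Measurable w ∧ (∀ r, R₀ < r → w r = 0) ∧ (∫⁻ x : Space, w ‖x‖) ≤ ENNReal.ofReal V₁

end Vocabulary

/-! ## §2 The named statements of the line (registered stubs `stub_*` of `Lines/fsum-phase-pencil.lean`) -/

/-- **S1 — BACKFLOW BOUND (the load; XL; registered `stub_backflowBound`, the HARDEST stub).** Uniformly over every
class `𝒱(R₀,V₁)` and window `κ`: for `ρ < ρ₀`, eventually in `N`, every window mode, every `ε > 0`, some `δ > 0`,
every `δ`-near-minimiser `Ψ`: `|β_k(Ψ)| ≤ C·(N√ρ‖k̃‖ + √N ‖k̃‖² ‖U_kΨ‖) + ε`, where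
`β_k(Ψ) := Re⟨U_kΨ, W_kΨ⟩ − ‖k̃‖²‖U_kΨ‖² = Re⟨U_kΨ, R_kΨ⟩` is the correlation of the condensate phase quadrature
with the non-condensate longitudinal current `R_k = W_k − ‖k̃‖²U_k`. The WEAKEST hypothesis the composition digests;
implied by the static current bound `‖R_kΨ‖² ≤ C N ‖k̃‖⁴` (`StaticBackflowCurrent`, Cauchy–Schwarz) and by the pure
correlation bound `|β_k| ≤ C N√ρ‖k̃‖`. Free gas: `R_kΨ₀ = 0`; Bogoliubov: `‖R_kΨ₀‖² ≈ 1.4·N√(ρa³)‖k̃‖⁴`. Why it might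
fail: the `O(k²)` of `‖J′_kΨ₀‖²` is a normal/anomalous cancellation to be held non-perturbatively and uniformly down to
`‖k̃‖ = 2π/L`. A statement of the proof plan, not a result in print. -/
def BackflowBound : Prop :=
  ∀ R₀ V₁ : ℝ, 0 < R₀ → 0 ≤ V₁ → ∀ κ : ℝ, 0 < κ →
    ∃ ρ₀ : ℝ, 0 < ρ₀ ∧ ∃ C : ℝ, 0 < C ∧ ∀ ρ : ℝ, 0 < ρ → ρ < ρ₀ → ∀ᶠ N : ℕ in atTop,
      ∀ w : ℝ → ℝ≥0∞, InClass R₀ V₁ w →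
        periodicGroundStateEnergy w N (sideLength ρ N) ≠ ⊤ →
        ∀ k : Fin 3 → ℤ, InWindow κ ρ N k → ∀ ε : ℝ, 0 < ε → ∃ δ : ℝ≥0∞, 0 < δ ∧
          ∀ Ψ : PeriodicTrialState N (sideLength ρ N), NearMin w ρ N δ Ψ →
            |innerRe (sideLength ρ N) (phaseUp (sideLength ρ N) k Ψ.ψ)
                  (kinCommutator (sideLength ρ N) k Ψ.ψ) -
                ‖waveVector (sideLength ρ N) k‖ ^ 2 *
                  (normSq (sideLength ρ N) (phaseUp (sideLength ρ N) k Ψ.ψ)).toReal| ≤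
              C * (N * Real.sqrt ρ * ‖waveVector (sideLength ρ N) k‖ +
                    Real.sqrt N * ‖waveVector (sideLength ρ N) k‖ ^ 2 *
                      Real.sqrt ((normSq (sideLength ρ N) (phaseUp (sideLength ρ N) k Ψ.ψ)).toReal)) + ε

/-- **S2 — PHASE CONE BLOCK (M–L, provable now; registered `stub_phaseConeBlock`).** At GENERAL `(N, L)`, for
admissible integrable `w` with `E₀^per < ∞`, every `k ≠ 0` and `ε > 0` there is `δ > 0` such that every `δ`-near-minimiser
`Ψ` satisfies `|Re⟨U_kΨ, W_kΨ⟩| ≤ √( Q_{E₀}(U_kΨ) · (2N‖k̃‖² + ε) ) + ε`. Content: (a) `U_kΨ`, `ρ_k†Ψ = GΨ`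
(`G = ∑ⱼ e_k(xⱼ)`), `|G|²Ψ`, `ḠU_kΨ` are core functions (`WF.isCore_modeAn/modeCr`, products with smooth periodic
symmetric multipliers) with forms bounded by `C(N,L,k,w)(𝓔[Ψ] + 1)` (`WF.qform_modeAn_le/qform_modeCr_le`); (b) cone
Cauchy–Schwarz `(Re B(f,g) − E₀Re⟨f,g⟩)² ≤ Q_{E₀}(f) Q_{E₀}(g)` for cores (`WF.qform_add_smul`, `WF.normSq_add_smul`,
`WF.groundStateEnergy_mul_normSq_le`, discriminant); (c) f-sum: `Q(GΨ) + Q(ḠΨ) = 2N‖k̃‖²‖Ψ‖² + 2(Re B(|G|²Ψ,Ψ) −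
E₀Re⟨|G|²Ψ,Ψ⟩)` (pointwise identity, `|∇G|² = N‖k̃‖²`) and `|Re B(Ψ,|G|²Ψ) − E₀Re⟨Ψ,|G|²Ψ⟩| ≤ √δ√𝓔[|G|²Ψ]`
(`WF.abs_formRe_sub_le`), so `Q(GΨ) ≤ 2N‖k̃‖² + 2C√δ` (drop `Q(ḠΨ) ≥ 0`); (d) one periodic integration by parts
(`integral_cellN_mul_fderiv_apply`): `Re B(U_kΨ, GΨ) = Re⟨U_kΨ, W_kΨ⟩ + Re B(ḠU_kΨ, Ψ)`, and `Re⟨U_kΨ, GΨ⟩ =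
Re⟨ḠU_kΨ, Ψ⟩`, whence `|Re⟨U,WΨ⟩| ≤ √(Q(U)Q(GΨ)) + √δ√𝓔[ḠU]`. Free gas: saturated up to the factor `2`. Why it might
fail: it cannot (calculus + linear algebra on the torus). -/
def PhaseConeBlock : Prop :=
  ∀ w : ℝ → ℝ≥0∞, IsRepulsiveFiniteRange w → (∫⁻ x : Space, w ‖x‖) ≠ ⊤ →
    ∀ (N : ℕ) (L : ℝ), 0 < L → periodicGroundStateEnergy w N L ≠ ⊤ →
      ∀ k : Fin 3 → ℤ, k ≠ 0 → ∀ ε : ℝ, 0 < ε → ∃ δ : ℝ≥0∞, 0 < δ ∧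
        ∀ Ψ : PeriodicTrialState N L, periodicEnergy w Ψ ≤ periodicGroundStateEnergy w N L + δ →
          |innerRe L (phaseUp L k Ψ.ψ) (kinCommutator L k Ψ.ψ)| ≤
            Real.sqrt (eform w L (periodicGroundStateEnergy w N L).toReal (phaseUp L k Ψ.ψ) *
                (2 * N * ‖waveVector L k‖ ^ 2 + ε)) + ε

/-- **S3 — PHASE DOUBLE COMMUTATOR (L–XL; registered `stub_phaseDoubleCommutator`).** Uniformly over `𝒱(R₀,V₁)`:
`Q_{E₀}(U_kΨ) ≤ C·N·(‖k̃‖² + ρ) + ε` for `δ`-near-minimisers (`δ` after `N, k, ε`). Content: symmetrise with the partner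
`U_k† = −U₋ₖ`: `Q(U_kΨ) ≤ Q(U_kΨ) + Q(U₋ₖΨ) = ⟨[U_k†,[H,U_k]]⟩_Ψ + (Re B(U†UΨ,Ψ) − E₀Re⟨U†UΨ,Ψ⟩-type defects
≤ C√δ` by `WF.abs_formRe_sub_le`). Kinetic part by Parseval (`WF` kinetic Parseval `formRe_zero_eq_tsum`) and the CCR on
plane-wave modes (`modeAn_modeCr_planeWaveMode`): `[T, U_k] = ‖k̃‖² P_k`, `[U_k†, P_k] = 2n̂₀ − n̂_k − n̂₋ₖ`, so the kinetic
double commutator is `≤ 2N‖k̃‖²`. Interaction part: `[U_k†,[V,U_k]]` is a two-body operator; every term is an integral of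
`w^per(xᵢ−xⱼ)` against products of `Ψ` and cell-averages of `Ψ` in ONE variable, bounded by the smoothing bound
`|a†(φ)a(ψ)-term|² ≤ L⁻³∫_cell|Ψ(X[i↦y])|²dy` (state-independent `∫w(xᵢ−xⱼ)·(…) ≤ L⁻³‖w‖₁`, the pattern of
`WF.potForm_modeCr_le`) and Cauchy–Schwarz against `⟨V⟩_Ψ ≤ 𝓔[Ψ] ≤ E₀ + δ ≤ ½NρV₁ + δ` (Hartree bound by the
constant trial state). Total `≤ 2N‖k̃‖² + C′NρV₁`. Free gas: `Q(U_kΨ₀) = N‖k̃‖²`; Bogoliubov `N₀(‖k̃‖² + 2·8πρa)`. Why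
it might fail: an EXPECTATION (not a norm), so only the bookkeeping of the `O(N²)` pair terms into `N·ρ·∫w` is at stake. -/
def PhaseDoubleCommutator : Prop :=
  ∀ R₀ V₁ : ℝ, 0 < R₀ → 0 ≤ V₁ → ∀ κ : ℝ, 0 < κ →
    ∃ ρ₀ : ℝ, 0 < ρ₀ ∧ ∃ C : ℝ, 0 < C ∧ ∀ ρ : ℝ, 0 < ρ → ρ < ρ₀ → ∀ᶠ N : ℕ in atTop,
      ∀ w : ℝ → ℝ≥0∞, InClass R₀ V₁ w →
        periodicGroundStateEnergy w N (sideLength ρ N) ≠ ⊤ →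
        ∀ k : Fin 3 → ℤ, InWindow κ ρ N k → ∀ ε : ℝ, 0 < ε → ∃ δ : ℝ≥0∞, 0 < δ ∧
          ∀ Ψ : PeriodicTrialState N (sideLength ρ N), NearMin w ρ N δ Ψ →
            eform w (sideLength ρ N) (periodicGroundStateEnergy w N (sideLength ρ N)).toReal
                (phaseUp (sideLength ρ N) k Ψ.ψ) ≤
              C * N * (‖waveVector (sideLength ρ N) k‖ ^ 2 + ρ) + ε

/-- **S4 — THE CONDENSATE DENSITY QUADRATURE IS NOT ENHANCED (L–XL; registered `stub_condensateDensityQuadrature`).**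
Uniformly over `𝒱(R₀,V₁)`: `‖P_kΨ‖² ≤ C·N + ε` for `δ`-near-minimisers and window modes. Bogoliubov:
`N₀(u_k−v_k)² = N₀‖k̃‖/√(‖k̃‖²+2B) ≤ N₀`; free gas `= N`. Intended proof (mirror pencil `{P_k, U_k}`, triage power
counting): `(Re⟨P_kΨ,(H−E₀)U_kΨ⟩)² ≤ Q(P_kΨ)·Q(U_kΨ)` with `Q(P_kΨ) ≤ CN(‖k̃‖²+ρ)` as S3, `[T, U_k] = ‖k̃‖²P_k`, and the
renormalised mean-field identification `Re⟨P_kΨ,[V,U_k]Ψ⟩ ≥ 2B_r‖P_kΨ‖² − C′ρ√N‖P_kΨ‖ − C′ρN`, `B_r ≥ cρ`; then a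
quadratic inequality. Through `‖P_kΨ‖ ≥ ‖ρ_k†Ψ‖ − ‖ρ′_kΨ‖` it implies a bounded structure factor on the window —
expected, NOT in print. The card's norm version of (B3) is false by power counting; only this correlation form is
claimed. -/
def CondensateDensityQuadrature : Prop :=
  ∀ R₀ V₁ : ℝ, 0 < R₀ → 0 ≤ V₁ → ∀ κ : ℝ, 0 < κ →
    ∃ ρ₀ : ℝ, 0 < ρ₀ ∧ ∃ C : ℝ, 0 < C ∧ ∀ ρ : ℝ, 0 < ρ → ρ < ρ₀ → ∀ᶠ N : ℕ in atTop,
      ∀ w : ℝ → ℝ≥0∞, InClass R₀ V₁ w →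
        periodicGroundStateEnergy w N (sideLength ρ N) ≠ ⊤ →
        ∀ k : Fin 3 → ℤ, InWindow κ ρ N k → ∀ ε : ℝ, 0 < ε → ∃ δ : ℝ≥0∞, 0 < δ ∧
          ∀ Ψ : PeriodicTrialState N (sideLength ρ N), NearMin w ρ N δ Ψ →
            (normSq (sideLength ρ N) (condUp (sideLength ρ N) k Ψ.ψ)).toReal ≤ C * N + ε

/-- **S5a (per class) — CONDENSATE-NUMBER VARIANCE / NO CAT (XL, open in the thermodynamic box; registered through
`CondensateNumberVariance` as `stub_condensateNumberVariance`).** Uniformly over `𝒱(R₀,V₁)`: for `ρ < ρ₀`, eventually in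
`N`, some `δ > 0`, every `δ`-near-minimiser has `Var_Ψ(n̂₀) = ‖n̂₀Ψ‖² − ⟨Ψ,n̂₀Ψ⟩² ≤ C·N`, where `n̂₀Ψ = transfer L 0 0 Ψ
= a₀†a₀Ψ` and `⟨Ψ,n̂₀Ψ⟩ = n₀(Ψ)` (`WF.innerRe_numOp`: the tree's `cellOccupation N L (planeWaveMode L 0)`, as a real).
Bogoliubov: `2√π√(ρa³)·N`; free gas `0`. Proved only in GP/mean-field scalings (LNSS arXiv:1211.2778;
Boccato–Brennecke–Cenatiempo–Schlein); sibling obligation `BECNudgeWalk.CondensateVariance` (stmt-AtomisticToContinuum-14360).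
Why the line needs it: every generator with a condensate leg is blind to the sector `n₀ ≪ N`; a second-moment (no-cat)
input is necessary for ANY condensate-leg certificate. -/
def CondensateNumberVarianceClass (R₀ V₁ : ℝ) : Prop :=
  ∃ ρ₀ : ℝ, 0 < ρ₀ ∧ ∃ C : ℝ, 0 < C ∧ ∀ ρ : ℝ, 0 < ρ → ρ < ρ₀ → ∀ᶠ N : ℕ in atTop,
    ∀ w : ℝ → ℝ≥0∞, InClass R₀ V₁ w →
      periodicGroundStateEnergy w N (sideLength ρ N) ≠ ⊤ →
      ∃ δ : ℝ≥0∞, 0 < δ ∧ ∀ Ψ : PeriodicTrialState N (sideLength ρ N), NearMin w ρ N δ Ψ →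
        (normSq (sideLength ρ N) (transfer (sideLength ρ N) 0 0 Ψ.ψ)).toReal ≤
          innerRe (sideLength ρ N) Ψ.ψ (transfer (sideLength ρ N) 0 0 Ψ.ψ) ^ 2 + C * N

/-- **S5a — `CondensateNumberVarianceClass` for every class** (registered `stub_condensateNumberVariance`). -/
def CondensateNumberVariance : Prop :=
  ∀ R₀ V₁ : ℝ, 0 < R₀ → 0 ≤ V₁ → CondensateNumberVarianceClass R₀ V₁

/-- **The n₀-WEIGHTED infrared bound for a class** (the OUTPUT of S1–S4, `weightedClassBound_of` in the skeleton; the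
INPUT of S5): uniformly over `𝒱(R₀,V₁)`, for every window `κ` there are `ρ₀, C` with: `ρ < ρ₀`, eventually in `N`,
every window mode, some `δ > 0`, every `δ`-near-minimiser: `‖U_kΨ‖² + ‖P_kΨ‖² ≤ C·N·√ρ L_N/‖k‖_∞`, i.e. (parallelogram
law) `⟨n₀ n_k⟩_Ψ + ⟨(n₀+1)n₋ₖ⟩_Ψ ≤ ½C N√ρL/‖k‖_∞`. A statement of the proof plan (output shape of S1–S4). -/
def WeightedClassBound (R₀ V₁ : ℝ) : Prop :=
  ∀ κ : ℝ, 0 < κ → ∃ ρ₀ : ℝ, 0 < ρ₀ ∧ ∃ C : ℝ, 0 < C ∧ ∀ ρ : ℝ, 0 < ρ → ρ < ρ₀ → ∀ᶠ N : ℕ in atTop,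
    ∀ w : ℝ → ℝ≥0∞, InClass R₀ V₁ w →
      periodicGroundStateEnergy w N (sideLength ρ N) ≠ ⊤ →
      ∀ k : Fin 3 → ℤ, InWindow κ ρ N k → ∃ δ : ℝ≥0∞, 0 < δ ∧
        ∀ Ψ : PeriodicTrialState N (sideLength ρ N), NearMin w ρ N δ Ψ →
          (normSq (sideLength ρ N) (phaseUp (sideLength ρ N) k Ψ.ψ)).toReal +
              (normSq (sideLength ρ N) (condUp (sideLength ρ N) k Ψ.ψ)).toReal ≤
            C * N * Real.sqrt ρ * sideLength ρ N / ‖(fun j => (k j : ℝ))‖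

/-- **S5 — NORMALISATION BOOTSTRAP (L–XL; registered `stub_normalisationBootstrap`).** For every class: no-cat (S5a on
the class) + the weighted class bound (all windows `κ`) ⇒ `IRBoundFor w` for every `w` of the class. Intended proof
(all at fixed `(N, L)`, `δ` after `N`): (1) kinematics `‖U_kΨ‖² + ‖P_kΨ‖² = 2⟨n₀(n_k+1)⟩ + 2⟨n₋ₖ(n₀+1)⟩ ≥ 2⟨n₀n_k⟩`
(CCR on plane-wave modes, `modeAn_modeCr_planeWaveMode`, adjointness `integral_conj_modeCr_mul`); (2) weighted mode
counting on a window `κ′ ≥ κ` (`∑_{0<‖k‖_∞≤K} 1/‖k‖_∞ ≤ 12K² + 2`) and the UV tail by Parseval/Markov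
(`Negative.cellOccupation_le_energy_div`, Hartree bound `⟨Ψ,HΨ⟩ ≤ ½NρV₁ + δ`), whence `E[n₀(N−n₀)] ≤ N²/8`; (3) with
`x = E n₀/N` and no-cat: `x(1−x) ≤ 1/8 + C_V/N`, so `x ∉ (0.16, 0.84)` for `N` large, for EVERY coupling `λ ∈ [0,1]`
(`λw ∈ 𝒱(R₀,V₁)`: the class-uniformity of the stubs); (4) coupling continuity at fixed `(N, L)`: `λ ↦ x_λ` continuous
on `[0,1]` with `x₀ = 1` (simple ground state of `T + λV`, Perron–Frobenius — the tree's
`BECGroundStateSOSPeriodicIRBoundZeroMomentumGapIntegrable` chain gives `2E₀ < kyFanTwo`), hence `x ≥ 0.84` at `λ = 1`;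
(5) Chebyshev on the law of `n̂₀` (a sum of commuting rank-one projections): `N·P(n₀ < N/2) ≤ 9C_V`, so
`n_k ≤ (2/N)E[n₀n_k] + 9C_V ≤ (C + 9C_Vκ)√ρL/‖k‖_∞`; (6) `δ`-bookkeeping into `IRBoundFor` (`Negative.irBoundWith_of_ground`,
`Negative.inWindow_mem_box`). Why it might fail: (4)–(5) need the near-minimiser ⇄ ground-state dictionary and the spectral
calculus of `n̂₀` at fixed `(N, L)` — standard, only partly in the tree. -/
def NormalisationBootstrap : Prop :=
  ∀ R₀ V₁ : ℝ, 0 < R₀ → 0 ≤ V₁ →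
    CondensateNumberVarianceClass R₀ V₁ → WeightedClassBound R₀ V₁ →
      ∀ w : ℝ → ℝ≥0∞, InClass R₀ V₁ w → IRBoundFor w

/-- **S6 — THE NON-INTEGRABLE HALF (XL; registered `stub_nonIntegrableHalf`; NOT REDUCED by this line).** `IRBoundFor v`
for admissible `v` with `∫v(|x|)dx = ∞` (hard cores), which the crux demands verbatim (`Negative` §19 `hardCore_in_scope`,
`periodicIRBound_iff_split`). The undressed pencil is void there (`Q(U_kΨ) = +∞`) and its constants grow with `∫v`;
intended proof = the Jastrow/Dyson-DRESSED pencil; shared debt with stmt-AtomisticToContinuum-11844 and with the sibling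
line's stub 6b `LinearPhFloorWagner.HardCoreWagnerFeynmanBound`. It IS the crux on a sub-class. -/
def NonIntegrableHalf : Prop :=
  ∀ v : ℝ → ℝ≥0∞, IsRepulsiveFiniteRange v → (∫⁻ x : Space, v ‖x‖) = ⊤ → IRBoundFor v

/-- **Typed alternative for S1: the STATIC backflow-current bound** `‖R_kΨ‖² ≤ C N ‖k̃‖⁴ + ε`
(`R_k = W_k − ‖k̃‖²U_k`) — implies `BackflowBound` by Cauchy–Schwarz on the cell. A statement of the proof plan,
not a result in print. -/
def StaticBackflowCurrent : Prop :=
  ∀ R₀ V₁ : ℝ, 0 < R₀ → 0 ≤ V₁ → ∀ κ : ℝ, 0 < κ →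
    ∃ ρ₀ : ℝ, 0 < ρ₀ ∧ ∃ C : ℝ, 0 < C ∧ ∀ ρ : ℝ, 0 < ρ → ρ < ρ₀ → ∀ᶠ N : ℕ in atTop,
      ∀ w : ℝ → ℝ≥0∞, InClass R₀ V₁ w →
        periodicGroundStateEnergy w N (sideLength ρ N) ≠ ⊤ →
        ∀ k : Fin 3 → ℤ, InWindow κ ρ N k → ∀ ε : ℝ, 0 < ε → ∃ δ : ℝ≥0∞, 0 < δ ∧
          ∀ Ψ : PeriodicTrialState N (sideLength ρ N), NearMin w ρ N δ Ψ →
            (normSq (sideLength ρ N) (fun X => kinCommutator (sideLength ρ N) k Ψ.ψ X -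
                (((‖waveVector (sideLength ρ N) k‖ ^ 2 : ℝ)) : ℂ) * phaseUp (sideLength ρ N) k Ψ.ψ X)).toReal ≤
              C * N * ‖waveVector (sideLength ρ N) k‖ ^ 4 + ε

/-! ## §3 The cone is non-negative (registered by-product sub-goal `stub_eformNonneg`) -/

/-- **`Q_{E₀} ≥ 0` on core functions**: for a core `f` (`C¹`, periodic, Bose-symmetric) with finite form,
`0 ≤ 𝓔_w[f] − E₀^per‖f‖²` as real numbers — the unnormalised variational principle
(`periodicGroundStateEnergy_mul_normSq_le`: `E₀‖f‖² ≤ 𝓔_w[f]` in `ℝ≥0∞`) transported through `toReal` (if `‖f‖² ≠ 0` and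
`E₀ = ⊤` the form would be `⊤`). The registered by-product sub-goal `stub_eformNonneg` of the crux ledger; used by the
stub files S2/S3 (cone Cauchy–Schwarz) and by the skeleton. [folklore] -/
theorem stub_eformNonneg : ∀ {N : ℕ} {L : ℝ} (w : ℝ → ℝ≥0∞) {f : Config N → ℂ}, IsCore L f →
    qform w L f ≠ ⊤ → 0 ≤ eform w L (periodicGroundStateEnergy w N L).toReal f := by
  intro N L w f hf hq
  have hle : periodicGroundStateEnergy w N L * normSq L f ≤ qform w L f :=
    periodicGroundStateEnergy_mul_normSq_le w hf.contDiff hf.periodic hf.symm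
  have hne : periodicGroundStateEnergy w N L * normSq L f ≠ ⊤ := ne_top_of_le_ne_top hq hle
  have hreal := (ENNReal.toReal_le_toReal hne hq).2 hle
  rw [ENNReal.toReal_mul] at hreal
  unfold eform
  linarith

/-! ## §4 Weaker replacement of S4 (seat c8 reshape): the SIGN of the condensate pairing amplitude -/

/-- **S4′ — CONDENSATE PAIRING SIGN (registered `stub_condensatePairingSign`; a strictly WEAKER replacement of
S4 `CondensateDensityQuadrature` in the composition).** Uniformly over `𝒱(R₀,V₁)`: for `ρ < ρ₀`, eventually in `N`,
every window mode, every `ε > 0`, some `δ > 0`, every `δ`-near-minimiser `Ψ`: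
`Re⟨T_{k0}Ψ, T_{0,−k}Ψ⟩ = Re⟨Ψ, a₀†a₀†a_k a₋ₖ Ψ⟩ ≤ C·N + ε` (`T_{ab} = transfer L a b = a†(φ_a)a(φ_b)`), a one-sided
bound on the real part of the condensate pair-annihilation amplitude `A_k = ⟨a₀a₀Ψ, a_ka₋ₖΨ⟩`. WHY IT REPLACES S4:
`‖U_kΨ‖² = ‖T_{k0}Ψ‖² + ‖T_{0,−k}Ψ‖² − 2Re A_k` and `‖P_kΨ‖² = ‖T_{k0}Ψ‖² + ‖T_{0,−k}Ψ‖² + 2Re A_k` (polarisation),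
so the `n₀`-weighted occupations `‖T_{k0}Ψ‖² = n₀ + ⟨n₀n_k⟩` are recovered from the phase quadrature ALONE once
`Re A_k ≤ CN`: `‖T_{k0}Ψ‖² + ‖T_{0,−k}Ψ‖² ≤ ‖U_kΨ‖² + 2CN + 2ε`, and the composition's S4-slot `np ≤ C₄N + N` is fed with
`np := ‖T_{k0}Ψ‖² + ‖T_{0,−k}Ψ‖² − ‖U_kΨ‖²` (`weightedClassBound_of_pairingSign` in the line's reduction file; S4 ⇒ S4′
with the same constant, since `2Re A_k = ‖P_kΨ‖² − ‖T_{k0}Ψ‖² − ‖T_{0,−k}Ψ‖² ≤ ‖P_kΨ‖²`). WHY IT IS PLAUSIBLE: for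
REPULSIVE interactions Bogoliubov theory gives `Re A_k ≈ N₀⟨a_ka₋ₖ⟩ = −N₀u_kv_k ≈ −N√(2πaρ)/‖k̃‖ < 0` — NEGATIVE and
large (the depletion pairs interfere destructively with the condensate in the density quadrature, `S(k) = (u−v)² < 1`;
equivalently the `k`-mode is squeezed in the DENSITY quadrature, `‖P_kΨ‖² ≤ ‖U_kΨ‖²`); for a Jastrow state
`∏f(xᵢ−xⱼ)` with a non-negative decreasing correlation hole `h = 1 − f`, `Re A_k = −ĥ(k)·(positive) < 0`. So S4′ has
room of order `N√ρa/‖k̃‖ ≫ N`: it fails only if the ground state ANTI-squeezes the condensate legs by a super-extensive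
amount — whereas S4 (`‖P_kΨ‖² ≤ CN`) is the sharp Bogoliubov-level statement `N(u_k−v_k)² ≤ N`. A statement of the
proof plan (candidate handle: Perron–Frobenius positivity of the torus ground state and the pair-Fourier structure of
`A_k = ∑_{i≠j} L⁻⁶∫ conj(Ψ̄ᵢⱼ)·Ψ̂ᵢⱼ(k)`), not a result in print. -/
def CondensatePairingSign : Prop :=
  ∀ R₀ V₁ : ℝ, 0 < R₀ → 0 ≤ V₁ → ∀ κ : ℝ, 0 < κ →
    ∃ ρ₀ : ℝ, 0 < ρ₀ ∧ ∃ C : ℝ, 0 < C ∧ ∀ ρ : ℝ, 0 < ρ → ρ < ρ₀ → ∀ᶠ N : ℕ in atTop,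
      ∀ w : ℝ → ℝ≥0∞, InClass R₀ V₁ w →
        periodicGroundStateEnergy w N (sideLength ρ N) ≠ ⊤ →
        ∀ k : Fin 3 → ℤ, InWindow κ ρ N k → ∀ ε : ℝ, 0 < ε → ∃ δ : ℝ≥0∞, 0 < δ ∧
          ∀ Ψ : PeriodicTrialState N (sideLength ρ N), NearMin w ρ N δ Ψ →
            innerRe (sideLength ρ N) (transfer (sideLength ρ N) k 0 Ψ.ψ)
                (transfer (sideLength ρ N) 0 (-k) Ψ.ψ) ≤ C * N + ε

end Summit.AtomisticToContinuum.BoseEinsteinCondensation.Cruxes.PeriodicIRBound.FsumPhasePencil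

end
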